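import Summits.FinalStateConjecture.FinalStateConjecture.Theses.EIHFluxBalance

/-!
# Route EIHFluxBalance — `InertialRecession`, re-charting: coordinate cone confinement of causal
# curves in a lab chart

Helper file for the crux `stmt-FinalStateConjecture-10166`
(`Summit.FinalStateConjecture.FinalStateConjecture.Theses.EIHFluxBalance.InertialRecession`),
line `sublinear-is-free-clean-window-charges`, stub `stub_rechart` (the transfer P2, reshape r4).

In the lab chart of the crux antecedent the pulled-back metric is `C⁰`-close to a sum of
Kerr–Schild forms `η + Σ 2Hⱼ ℓⱼ ⊗ ℓⱼ` with `Hⱼ ≥ 0`, for which every causal vector `v` satisfies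
`η(v, v) ≤ 0`, i.e. `‖ṽ‖ ≤ |v⁰|`; with the perturbation, future causal coordinate velocities obey
the CONE CONDITION `‖ṽ‖ ≤ K v⁰` (`K = 1 + O(ε)`). This file draws the elementary consequence used
to confine the exhaustion curves of the causal transfer (step C3 of the route): along a
differentiable coordinate curve satisfying the cone condition, lab time is nondecreasing and the
lab position moves at most `K` times the lab time elapsed
(`spatial_dist_le_of_cone'`, registered one-line form unprimed) — a vector-valued mean value
inequality, proved by testing against unit covectors. Mathlib only.
-/

noncomputable section

set_option linter.dupNamespace false

open Set Filter Function Topology Literature.Geometry.Lorentzian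
open scoped InnerProductSpace

namespace Summit.FinalStateConjecture.FinalStateConjecture.Theorems.SublinearIsFree.Rechart

/-- **Cone confinement.** Let `c : ℝ → E4` be differentiable at every point of `[a, b]` with
`‖(c′ t)~‖ ≤ K (c′ t)⁰` there (`K > 0`). Then for `a ≤ s ≤ t ≤ b`: `(c s)⁰ ≤ (c t)⁰` and
`‖(c t)~ − (c s)~‖ ≤ K ((c t)⁰ − (c s)⁰)`. Proof: for every `w ∈ E3` with `‖w‖ ≤ 1` the scalar
function `K (c ·)⁰ − ⟪w, (c ·)~⟫` has nonnegative derivative on `[a, b]`, hence is monotone; take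
`w = ((c t)~ − (c s)~)/‖·‖`. [folklore] -/
theorem spatial_dist_le_of_cone' {c : ℝ → E4} {a b K : ℝ} (hK : 0 < K)
    (hc : ∀ t ∈ Icc a b, DifferentiableAt ℝ c t)
    (hcone : ∀ t ∈ Icc a b, ‖E4.spatial (deriv c t)‖ ≤ K * (deriv c t) 0)
    {s t : ℝ} (hs : s ∈ Icc a b) (ht : t ∈ Icc a b) (hst : s ≤ t) :
    (c s) 0 ≤ (c t) 0 ∧ ‖E4.spatial (c t) - E4.spatial (c s)‖ ≤ K * ((c t) 0 - (c s) 0) := by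
  -- the scalar test functions
  have hderiv0 : ∀ u ∈ Icc a b, HasDerivAt (fun u ↦ (c u) 0) ((deriv c u) 0) u := fun u hu ↦ by
    have h := (hc u hu).hasDerivAt
    exact ((EuclideanSpace.proj (0 : Fin 4) : E4 →L[ℝ] ℝ).hasFDerivAt.comp_hasDerivAt u h)
  have hderivS : ∀ u ∈ Icc a b, HasDerivAt (fun u ↦ E4.spatial (c u)) (E4.spatial (deriv c u)) u :=
    fun u hu ↦ (E4.spatial).hasFDerivAt.comp_hasDerivAt u (hc u hu).hasDerivAt
  have key : ∀ w : E3, ‖w‖ ≤ 1 →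
      ⟪w, E4.spatial (c t) - E4.spatial (c s)⟫_ℝ ≤ K * ((c t) 0 - (c s) 0) := by
    intro w hw
    -- `g u = K (c u)⁰ − ⟪w, (c u)~⟫` is monotone on `[a, b]`
    set g : ℝ → ℝ := fun u ↦ K * (c u) 0 - ⟪w, E4.spatial (c u)⟫_ℝ with hg
    have hg' : ∀ u ∈ Icc a b, HasDerivAt g (K * (deriv c u) 0 - ⟪w, E4.spatial (deriv c u)⟫_ℝ) u :=
      fun u hu ↦ ((hderiv0 u hu).const_mul K).sub
        (((hasDerivAt_const u w).inner ℝ (hderivS u hu)).congr_deriv (by simp))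
    have hmono : MonotoneOn g (Icc a b) := by
      refine monotoneOn_of_deriv_nonneg (convex_Icc a b)
        (fun u hu ↦ (hg' u hu).continuousAt.continuousWithinAt)
        (fun u hu ↦ (hg' u (interior_subset hu)).differentiableAt.differentiableWithinAt) ?_
      intro u hu
      rw [(hg' u (interior_subset hu)).deriv]
      have h1 := hcone u (interior_subset hu)
      have h2 : ⟪w, E4.spatial (deriv c u)⟫_ℝ ≤ ‖E4.spatial (deriv c u)‖ :=
        (real_inner_le_norm _ _).trans (by nlinarith [norm_nonneg (E4.spatial (deriv c u))])
      linarith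
    have h := hmono hs ht hst
    simp only [hg, inner_sub_right] at h ⊢
    linarith
  have hΔ : 0 ≤ (c t) 0 - (c s) 0 := by
    have h := key 0 (by simp)
    rw [inner_zero_left] at h
    exact le_of_mul_le_mul_left (by simpa using h) hK
  constructor
  · linarith
  · set d : E3 := E4.spatial (c t) - E4.spatial (c s) with hd
    rcases eq_or_ne d 0 with hd0 | hd0
    · rw [hd0, norm_zero]
      exact mul_nonneg hK.le hΔ
    · have hpos : 0 < ‖d‖ := norm_pos_iff.mpr hd0
      have h := key (‖d‖⁻¹ • d) (by rw [norm_smul, norm_inv, norm_norm, inv_mul_cancel₀ hpos.ne'])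
      rw [real_inner_smul_left, real_inner_self_eq_norm_sq] at h
      have : ‖d‖⁻¹ * ‖d‖ ^ 2 = ‖d‖ := by field_simp
      linarith

/-- Registered sub-goal form (stub `spatial_dist_le_of_cone` of the crux item) of
`spatial_dist_le_of_cone'`: cone confinement of coordinate curves. [folklore] -/
theorem spatial_dist_le_of_cone : open Literature.Geometry.Lorentzian Set in ∀ {c : ℝ → E4} {a b K : ℝ}, 0 < K → (∀ t ∈ Icc a b, DifferentiableAt ℝ c t) → (∀ t ∈ Icc a b, ‖E4.spatial (deriv c t)‖ ≤ K * (deriv c t) 0) → ∀ {s t : ℝ}, s ∈ Icc a b → t ∈ Icc a b → s ≤ t → (c s) 0 ≤ (c t) 0 ∧ ‖E4.spatial (c t) - E4.spatial (c s)‖ ≤ K * ((c t) 0 - (c s) 0) :=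
  fun hK hc hcone _ _ hs ht hst ↦ spatial_dist_le_of_cone' hK hc hcone hs ht hst

end Summit.FinalStateConjecture.FinalStateConjecture.Theorems.SublinearIsFree.Rechart

end
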